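import Summits.CriticalPhenomena.PercolationContinuityZ3.Theorems.PercNonProliferationFreeBoxPowerSavingInterfaceCrossMass
import Literature.Probability.Percolation.PlanarDuality
import HarnessLib

/-!
# Crux `PercNonProliferation.FreeBoxPowerSaving` (stmt-CriticalPhenomena-4447), line `Sketch-r2-ideator5`
# (card `subcritical-runaway-closure`) — stub `stub_straddlingGain`

Helper file for the checked skeleton of the crux `FreeBoxPowerSaving` (route
`PercNonProliferation`), line `Sketch-r2-ideator5`.  Proves exactly the registered stub signature
`stub_straddlingGain` (the STRADDLING GAIN of the free-box pair sum under tripling); lands with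
`--supports stmt-CriticalPhenomena-4447`.

## The statement

Bond percolation `P_p` on `ℤ³`, `B(n) = box 3 n = [-n, n]³`, free-box pair sum
`S_p(n) = Σ_{x, y ∈ B(n)} P_p(x ↔ y inside B(n))`, trans-equatorial pair masses
`X^{(i)}(n) = Σ_{x ∈ B(n), x_i ≤ -1} Σ_{y ∈ B(n), 0 ≤ y_i} P_p(x ↔ y inside B(n))`, `i < 3`.
For every `p` and `n`:  `27 S_p(n) + 36 Σ_{i<3} X^{(i)}(n) ≤ S_p(3n+1)`.

## The argument (Finset bookkeeping over the 27 blocks; every `p`)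

Write `N = 3n+1`, `F(a, b) = P_p(a ↔ b in B(N)) ≥ 0`, `c_v = (2n+1)(v - 1)` (`v ∈ {0,1,2}³`, the
27 blocks `c_v + B(n)` tile `B(N)`), and `M(v, w) = Σ_{x, y ∈ B(n)} F(x + c_v, y + c_w)`.

1. `Σ_{v, w} M(v, w) ≤ S_p(N)`: the map `((v, x), (w, y)) ↦ (x + c_v, y + c_w)` is injective into
   `B(N) × B(N)` (`SubBoxesSuperadditive.add_offset_injOn`, `add_offset_mem_box`), and `F ≥ 0`
   (`sum_blockPairs_le`).
2. Index level (`blockPairs_le`): the diagonal pairs `(v, v)`, the "up" pairs `(v, v + e_i)` and the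
   "down" pairs `(v + e_i, v)` are pairwise distinct elements of `({0,1,2}³)²`
   (`e_i ≠ 0`, `e_i + e_{i'} ≠ 0`, `e_i = e_{i'} → i = i'` in `(Fin 3 → Fin 3)`, by `decide`), so
   `Σ_v M(v, v) + Σ_i Σ_{v : v_i ≤ 1} (M(v, v + e_i) + M(v + e_i, v)) ≤ Σ_{v, w} M(v, w)`.
3. `M(v, v) ≥ S_p(n)` for each of the 27 blocks (`openConnIn_mono` + `stub_pairSumShift`;
   `diag_ge`), and for `v_i ≤ 1` (no wrap-around, `c_{v + e_i} = c_v + (2n+1) e_i`, `bump_offset`)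
   `M(v, v + e_i) ≥ X^{(i)}(n)` is the one-interface lemma `stub_interfaceCrossMass`, while
   `M(v + e_i, v) = M(v, v + e_i)` by the symmetry of `{a ↔ b in S}` (`openConnIn_comm`); there are
   `18` blocks `v` with `v_i ≤ 1` per direction (`decide`), whence `36 X^{(i)}` (`offdiag_ge`).

No new definitions.
-/

noncomputable section

open MeasureTheory
open Literature.Probability.Percolation Literature.Probability.LatticeModels
open scoped BigOperators

namespace Summit.CriticalPhenomena.PercolationContinuityZ3.FreeBoxPowerSavingLine

open SubBoxesSuperadditive

namespace StraddlingGain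

/-- **All block pairs form a sub-sum of the big-box pair sum.**  For a finite measure `μ` on bond
configurations of `ℤ³` and a finite family of offsets `c_v` such that every translate `c_v + B(m)`
lies in `B(N)` and `(v, x) ↦ x + c_v` is injective on `univ × B(m)`:
`Σ_{v, w} Σ_{x, y ∈ B(m)} μ(x + c_v ↔ y + c_w in B(N)) ≤ Σ_{a, b ∈ B(N)} μ(a ↔ b in B(N))`
(re-index the inner, then the outer sum along the injective map; drop non-negative terms). [folklore] -/
theorem sum_blockPairs_le (μ : Measure (BondConfig (Site 3))) [IsFiniteMeasure μ]
    {ι : Type*} [Fintype ι] {m N : ℕ} (c : ι → Site 3)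
    (hmem : ∀ v, ∀ x ∈ box 3 m, x + c v ∈ box 3 N)
    (hinj : Set.InjOn (fun q : ι × Site 3 => q.2 + c q.1)
      (↑((Finset.univ : Finset ι) ×ˢ box 3 m) : Set (ι × Site 3))) :
    ∑ v, ∑ w, ∑ x ∈ box 3 m, ∑ y ∈ box 3 m,
        μ.real (openConnIn (↑(box 3 N) : Set (Site 3)) (x + c v) (y + c w)) ≤
      ∑ a ∈ box 3 N, ∑ b ∈ box 3 N, μ.real (openConnIn (↑(box 3 N) : Set (Site 3)) a b) := by
  calc ∑ v, ∑ w, ∑ x ∈ box 3 m, ∑ y ∈ box 3 m,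
          μ.real (openConnIn (↑(box 3 N) : Set (Site 3)) (x + c v) (y + c w))
      = ∑ v, ∑ x ∈ box 3 m, ∑ q ∈ (Finset.univ : Finset ι) ×ˢ box 3 m,
          μ.real (openConnIn (↑(box 3 N) : Set (Site 3)) (x + c v) (q.2 + c q.1)) := by
        refine Finset.sum_congr rfl fun v _ => ?_
        rw [Finset.sum_comm]
        refine Finset.sum_congr rfl fun x _ => ?_
        exact Eq.symm (Finset.sum_product _ _ _)
    _ ≤ ∑ v, ∑ x ∈ box 3 m, ∑ b ∈ box 3 N,
          μ.real (openConnIn (↑(box 3 N) : Set (Site 3)) (x + c v) b) := by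
        refine Finset.sum_le_sum fun v _ => Finset.sum_le_sum fun x _ => ?_
        exact sum_comp_le_of_injOn ((Finset.univ : Finset ι) ×ˢ box 3 m) (box 3 N)
          (fun q => q.2 + c q.1)
          (fun b => μ.real (openConnIn (↑(box 3 N) : Set (Site 3)) (x + c v) b))
          (fun _ _ => measureReal_nonneg)
          (fun q hq => hmem q.1 q.2 (Finset.mem_product.1 hq).2) hinj
    _ = ∑ q ∈ (Finset.univ : Finset ι) ×ˢ box 3 m, ∑ b ∈ box 3 N,
          μ.real (openConnIn (↑(box 3 N) : Set (Site 3)) (q.2 + c q.1) b) := by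
        rw [Finset.sum_product]
    _ ≤ ∑ a ∈ box 3 N, ∑ b ∈ box 3 N, μ.real (openConnIn (↑(box 3 N) : Set (Site 3)) a b) :=
        sum_comp_le_of_injOn ((Finset.univ : Finset ι) ×ˢ box 3 m) (box 3 N) (fun q => q.2 + c q.1)
          (fun a => ∑ b ∈ box 3 N, μ.real (openConnIn (↑(box 3 N) : Set (Site 3)) a b))
          (fun _ _ => Finset.sum_nonneg fun _ _ => measureReal_nonneg)
          (fun q hq => hmem q.1 q.2 (Finset.mem_product.1 hq).2) hinj

/-- Three pairwise disjoint sub-sums of a sum of non-negative terms add up to at most the whole sum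
(`Finset.sum_union` twice + `Finset.sum_le_sum_of_subset_of_nonneg`). [folklore] -/
theorem sum_add_sum_add_sum_le {α : Type*} [DecidableEq α] {A B C t : Finset α} (G : α → ℝ)
    (hG : ∀ a ∈ t, 0 ≤ G a) (hA : A ⊆ t) (hB : B ⊆ t) (hC : C ⊆ t)
    (hAB : Disjoint A B) (hAC : Disjoint A C) (hBC : Disjoint B C) :
    ∑ a ∈ A, G a + ∑ a ∈ B, G a + ∑ a ∈ C, G a ≤ ∑ a ∈ t, G a := by
  rw [← Finset.sum_union hAB, ← Finset.sum_union (Finset.disjoint_union_left.2 ⟨hAC, hBC⟩)]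
  exact Finset.sum_le_sum_of_subset_of_nonneg
    (Finset.union_subset (Finset.union_subset hA hB) hC) fun a ha _ => hG a ha

/-- `e_i ≠ 0` in `(Fin 3 → Fin 3)`. [folklore] -/
theorem single_one_ne_zero : ∀ i : Fin 3, (Pi.single i 1 : Fin 3 → Fin 3) ≠ 0 := by
  decide

/-- `e_{i'} + e_i ≠ 0` in `(Fin 3 → Fin 3)` (no cancellation modulo `3`). [folklore] -/
theorem single_add_single_ne_zero :
    ∀ i i' : Fin 3, (Pi.single i' 1 + Pi.single i 1 : Fin 3 → Fin 3) ≠ 0 := by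
  decide

/-- `e_i = e_{i'}` in `(Fin 3 → Fin 3)` forces `i = i'`. [folklore] -/
theorem single_one_inj :
    ∀ i i' : Fin 3, (Pi.single i 1 : Fin 3 → Fin 3) = Pi.single i' 1 → i = i' := by
  decide

/-- **Index-level bookkeeping.**  For a non-negative kernel `M` on block indices `{0,1,2}³` and any
families `T_i` of blocks: the diagonal pairs `(v, v)`, the up pairs `(v, v + e_i)` and the down pairs
`(v + e_i, v)` (`i < 3`, `v ∈ T_i`) are images of injective maps with pairwise disjoint images in
`({0,1,2}³)²`, so `Σ_v M(v, v) + Σ_i Σ_{v ∈ T_i} (M(v, v + e_i) + M(v + e_i, v)) ≤ Σ_{v, w} M(v, w)`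
(`Finset.sum_image`, `Finset.sum_union`, `Finset.sum_le_sum_of_subset_of_nonneg`). [folklore] -/
theorem blockPairs_le (M : (Fin 3 → Fin 3) → (Fin 3 → Fin 3) → ℝ) (hM : ∀ v w, 0 ≤ M v w)
    (T : Fin 3 → Finset (Fin 3 → Fin 3)) :
    ∑ v, M v v + ∑ i, ∑ v ∈ T i, (M v (v + Pi.single i 1) + M (v + Pi.single i 1) v) ≤
      ∑ v, ∑ w, M v w := by
  classical
  -- the adjacent block pairs, indexed by `(i, v)` with `v ∈ T i`
  set K : Finset (Fin 3 × (Fin 3 → Fin 3)) := Finset.univ.filter fun q => q.2 ∈ T q.1 with hK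
  have hKmem : ∀ q : Fin 3 × (Fin 3 → Fin 3), q ∈ K ↔ q.1 ∈ Finset.univ ∧ q.2 ∈ T q.1 :=
    fun q => by simp [hK]
  rw [← Finset.sum_finset_product' K Finset.univ T hKmem, Finset.sum_add_distrib, ← add_assoc]
  -- three injective parametrisations of pairs of block indices
  have hD : Set.InjOn (fun v : Fin 3 → Fin 3 => (v, v))
      ↑(Finset.univ : Finset (Fin 3 → Fin 3)) := fun v _ v' _ h => congrArg Prod.fst h
  have hU : Set.InjOn (fun q : Fin 3 × (Fin 3 → Fin 3) => (q.2, q.2 + Pi.single q.1 (1 : Fin 3)))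
      ↑K := by
    rintro ⟨i, v⟩ - ⟨i', v'⟩ - h
    simp only [Prod.mk.injEq] at h
    obtain ⟨rfl, h2⟩ := h
    rw [single_one_inj i i' (add_left_cancel h2)]
  have hU' : Set.InjOn (fun q : Fin 3 × (Fin 3 → Fin 3) => (q.2 + Pi.single q.1 (1 : Fin 3), q.2))
      ↑K := by
    rintro ⟨i, v⟩ - ⟨i', v'⟩ - h
    simp only [Prod.mk.injEq] at h
    obtain ⟨h1, rfl⟩ := h
    rw [single_one_inj i i' (add_left_cancel h1)]
  -- with pairwise disjoint images
  have hDU : Disjoint (Finset.univ.image fun v : Fin 3 → Fin 3 => (v, v))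
      (K.image fun q => (q.2, q.2 + Pi.single q.1 (1 : Fin 3))) := by
    refine Finset.disjoint_left.2 ?_
    simp only [Finset.mem_image, Finset.mem_univ, true_and]
    rintro _ ⟨v, rfl⟩ ⟨⟨i, w⟩, -, h⟩
    simp only [Prod.mk.injEq] at h
    obtain ⟨rfl, h⟩ := h
    exact single_one_ne_zero i (add_eq_left.1 h)
  have hDU' : Disjoint (Finset.univ.image fun v : Fin 3 → Fin 3 => (v, v))
      (K.image fun q => (q.2 + Pi.single q.1 (1 : Fin 3), q.2)) := by
    refine Finset.disjoint_left.2 ?_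
    simp only [Finset.mem_image, Finset.mem_univ, true_and]
    rintro _ ⟨v, rfl⟩ ⟨⟨i, w⟩, -, h⟩
    simp only [Prod.mk.injEq] at h
    obtain ⟨h, rfl⟩ := h
    exact single_one_ne_zero i (add_eq_left.1 h)
  have hUU' : Disjoint (K.image fun q => (q.2, q.2 + Pi.single q.1 (1 : Fin 3)))
      (K.image fun q => (q.2 + Pi.single q.1 (1 : Fin 3), q.2)) := by
    refine Finset.disjoint_left.2 ?_
    simp only [Finset.mem_image]
    rintro _ ⟨⟨i, w⟩, -, rfl⟩ ⟨⟨i', w'⟩, -, h⟩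
    simp only [Prod.mk.injEq] at h
    obtain ⟨h1, h2⟩ := h
    rw [← h1, add_assoc] at h2
    exact single_add_single_ne_zero i i' (add_eq_left.1 h2.symm)
  -- rewrite the four sums as sums over (images in) `({0,1,2}³)²`
  have eD : ∑ v, M v v =
      ∑ a ∈ Finset.univ.image (fun v : Fin 3 → Fin 3 => (v, v)), M a.1 a.2 := by
    rw [Finset.sum_image hD]
  have eU : ∑ q ∈ K, M q.2 (q.2 + Pi.single q.1 1) =
      ∑ a ∈ K.image (fun q => (q.2, q.2 + Pi.single q.1 (1 : Fin 3))), M a.1 a.2 := by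
    rw [Finset.sum_image hU]
  have eU' : ∑ q ∈ K, M (q.2 + Pi.single q.1 1) q.2 =
      ∑ a ∈ K.image (fun q => (q.2 + Pi.single q.1 (1 : Fin 3), q.2)), M a.1 a.2 := by
    rw [Finset.sum_image hU']
  have eT : ∑ v, ∑ w, M v w = ∑ a : (Fin 3 → Fin 3) × (Fin 3 → Fin 3), M a.1 a.2 :=
    (Fintype.sum_prod_type' M).symm
  rw [eD, eU, eU', eT]
  exact sum_add_sum_add_sum_le (fun a => M a.1 a.2) (fun a _ => hM a.1 a.2)
    (Finset.subset_univ _) (Finset.subset_univ _) (Finset.subset_univ _) hDU hDU' hUU'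

/-- For `v_i ≤ 1` the bumped block index `v + e_i` has coordinates `v_j + [j = i]`
(no wrap-around in `Fin 3`). [folklore] -/
theorem natCast_bump_apply (v : Fin 3 → Fin 3) (i : Fin 3) (hv : (v i : ℕ) ≤ 1) (j : Fin 3) :
    ((((v + Pi.single i 1 : Fin 3 → Fin 3) j : Fin 3) : ℕ) : ℤ) =
      ((v j : ℕ) : ℤ) + if j = i then 1 else 0 := by
  simp only [Pi.add_apply, Pi.single_apply]
  split_ifs with h
  · subst h
    have hlt : v j < Fin.last 2 := by
      rw [Fin.lt_def, Fin.val_last]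
      omega
    rw [Fin.val_add_one_of_lt hlt]
    push_cast
    ring
  · simp

/-- For `v_i ≤ 1` the offset of the bumped block is `c_{v + e_i} = c_v + (2n+1) e_i`. [folklore] -/
theorem bump_offset (n : ℕ) (v : Fin 3 → Fin 3) (i : Fin 3) (hv : (v i : ℕ) ≤ 1) :
    (fun j => (2 * (n : ℤ) + 1) *
        (((((v + Pi.single i 1 : Fin 3 → Fin 3) j : Fin 3) : ℕ) : ℤ) - 1)) =
      fun j => (2 * (n : ℤ) + 1) * (((v j : ℕ) : ℤ) - 1) +
        if j = i then (2 * (n : ℤ) + 1) else 0 := by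
  funext j
  rw [natCast_bump_apply v i hv j]
  split_ifs <;> ring

/-- **Diagonal blocks.**  `27 S_p(n) ≤ Σ_v Σ_{x, y ∈ B(n)} P_p(x + c_v ↔ y + c_v in B(3n+1))`:
each of the `27 = |{0,1,2}³|` blocks contributes at least `S_p(n)`
(`{x + c_v ↔ y + c_v in c_v + B(n)} ⊆ {… in B(3n+1)}`, `openConnIn_mono`, `add_offset_mem_box`;
translation invariance `stub_pairSumShift`). [folklore] -/
theorem diag_ge (p : unitInterval) (n : ℕ) :
    27 * (∑ x ∈ box 3 n, ∑ y ∈ box 3 n,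
        (bondPercolation (zdGraph 3) p).real (openConnIn (↑(box 3 n) : Set (Site 3)) x y)) ≤
      ∑ v : Fin 3 → Fin 3, ∑ x ∈ box 3 n, ∑ y ∈ box 3 n,
        (bondPercolation (zdGraph 3) p).real (openConnIn (↑(box 3 (3 * n + 1)) : Set (Site 3))
          (x + fun j => (2 * (n : ℤ) + 1) * (((v j : ℕ) : ℤ) - 1))
          (y + fun j => (2 * (n : ℤ) + 1) * (((v j : ℕ) : ℤ) - 1))) := by
  have hcard : (Finset.univ : Finset (Fin 3 → Fin 3)).card = 27 := by
    rw [Finset.card_univ]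
    decide
  have h27 : 27 * (∑ x ∈ box 3 n, ∑ y ∈ box 3 n,
        (bondPercolation (zdGraph 3) p).real (openConnIn (↑(box 3 n) : Set (Site 3)) x y)) =
      ∑ _v : Fin 3 → Fin 3, ∑ x ∈ box 3 n, ∑ y ∈ box 3 n,
        (bondPercolation (zdGraph 3) p).real (openConnIn (↑(box 3 n) : Set (Site 3)) x y) := by
    rw [Finset.sum_const, hcard, nsmul_eq_mul]
    norm_num
  rw [h27]
  refine Finset.sum_le_sum fun v _ => ?_
  rw [← stub_pairSumShift p n (fun j => (2 * (n : ℤ) + 1) * (((v j : ℕ) : ℤ) - 1))]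
  have himg : (fun w : Site 3 => w + fun j => (2 * (n : ℤ) + 1) * (((v j : ℕ) : ℤ) - 1)) ''
      (↑(box 3 n) : Set (Site 3)) ⊆ ↑(box 3 (3 * n + 1)) := by
    rintro _ ⟨w, hw, rfl⟩
    exact Finset.mem_coe.2 (add_offset_mem_box n v w (Finset.mem_coe.1 hw))
  refine Finset.sum_le_sum fun x _ => Finset.sum_le_sum fun y _ => ?_
  exact measureReal_mono (openConnIn_mono himg _ _) (measure_ne_top _ _)

/-- **Adjacent blocks.**  `36 Σ_i X^{(i)}(n) ≤ Σ_i Σ_{v : v_i ≤ 1} (M(v, v + e_i) + M(v + e_i, v))`,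
`M(v, w) = Σ_{x, y ∈ B(n)} P_p(x + c_v ↔ y + c_w in B(3n+1))`: per direction `i` there are `18`
blocks `v` with `v_i ≤ 1` (`decide`); for each, `c_{v + e_i} = c_v + (2n+1) e_i` (`bump_offset`),
`M(v, v + e_i) ≥ X^{(i)}(n)` (`stub_interfaceCrossMass`) and `M(v + e_i, v) = M(v, v + e_i)`
(`openConnIn_comm`, `Finset.sum_comm`). [folklore] -/
theorem offdiag_ge (p : unitInterval) (n : ℕ) :
    36 * (∑ i : Fin 3, ∑ x ∈ (box 3 n).filter (fun x : Site 3 => x i ≤ -1),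
        ∑ y ∈ (box 3 n).filter (fun y : Site 3 => 0 ≤ y i),
          (bondPercolation (zdGraph 3) p).real (openConnIn (↑(box 3 n) : Set (Site 3)) x y)) ≤
      ∑ i : Fin 3, ∑ v ∈ Finset.univ.filter (fun v : Fin 3 → Fin 3 => (v i : ℕ) ≤ 1),
        ((∑ x ∈ box 3 n, ∑ y ∈ box 3 n,
          (bondPercolation (zdGraph 3) p).real (openConnIn (↑(box 3 (3 * n + 1)) : Set (Site 3))
            (x + fun j => (2 * (n : ℤ) + 1) * (((v j : ℕ) : ℤ) - 1))
            (y + fun j => (2 * (n : ℤ) + 1) *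
              (((((v + Pi.single i 1 : Fin 3 → Fin 3) j : Fin 3) : ℕ) : ℤ) - 1)))) +
         (∑ x ∈ box 3 n, ∑ y ∈ box 3 n,
          (bondPercolation (zdGraph 3) p).real (openConnIn (↑(box 3 (3 * n + 1)) : Set (Site 3))
            (x + fun j => (2 * (n : ℤ) + 1) *
              (((((v + Pi.single i 1 : Fin 3 → Fin 3) j : Fin 3) : ℕ) : ℤ) - 1))
            (y + fun j => (2 * (n : ℤ) + 1) * (((v j : ℕ) : ℤ) - 1))))) := by
  rw [Finset.mul_sum]
  refine Finset.sum_le_sum fun i _ => ?_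
  have hcard : (Finset.univ.filter (fun v : Fin 3 → Fin 3 => (v i : ℕ) ≤ 1)).card = 18 := by
    revert i
    decide
  -- per-block bound: both orientations of the interface `(v, v + e_i)` carry at least `X^{(i)}`
  have hterm : ∀ v ∈ Finset.univ.filter (fun v : Fin 3 → Fin 3 => (v i : ℕ) ≤ 1),
      2 * (∑ x ∈ (box 3 n).filter (fun x : Site 3 => x i ≤ -1),
          ∑ y ∈ (box 3 n).filter (fun y : Site 3 => 0 ≤ y i),
            (bondPercolation (zdGraph 3) p).real (openConnIn (↑(box 3 n) : Set (Site 3)) x y)) ≤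
        (∑ x ∈ box 3 n, ∑ y ∈ box 3 n,
          (bondPercolation (zdGraph 3) p).real (openConnIn (↑(box 3 (3 * n + 1)) : Set (Site 3))
            (x + fun j => (2 * (n : ℤ) + 1) * (((v j : ℕ) : ℤ) - 1))
            (y + fun j => (2 * (n : ℤ) + 1) *
              (((((v + Pi.single i 1 : Fin 3 → Fin 3) j : Fin 3) : ℕ) : ℤ) - 1)))) +
        (∑ x ∈ box 3 n, ∑ y ∈ box 3 n,
          (bondPercolation (zdGraph 3) p).real (openConnIn (↑(box 3 (3 * n + 1)) : Set (Site 3))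
            (x + fun j => (2 * (n : ℤ) + 1) *
              (((((v + Pi.single i 1 : Fin 3 → Fin 3) j : Fin 3) : ℕ) : ℤ) - 1))
            (y + fun j => (2 * (n : ℤ) + 1) * (((v j : ℕ) : ℤ) - 1)))) := by
    intro v hv
    have hvi : (v i : ℕ) ≤ 1 := (Finset.mem_filter.1 hv).2
    rw [bump_offset n v i hvi]
    have h1 :=
      Summit.CriticalPhenomena.PercolationContinuityZ3.FreeBoxPowerSavingLine.stub_interfaceCrossMass
        p n i v hvi
    have hsymm : (∑ x ∈ box 3 n, ∑ y ∈ box 3 n,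
          (bondPercolation (zdGraph 3) p).real (openConnIn (↑(box 3 (3 * n + 1)) : Set (Site 3))
            (x + fun j => (2 * (n : ℤ) + 1) * (((v j : ℕ) : ℤ) - 1) +
              if j = i then (2 * (n : ℤ) + 1) else 0)
            (y + fun j => (2 * (n : ℤ) + 1) * (((v j : ℕ) : ℤ) - 1)))) =
        ∑ x ∈ box 3 n, ∑ y ∈ box 3 n,
          (bondPercolation (zdGraph 3) p).real (openConnIn (↑(box 3 (3 * n + 1)) : Set (Site 3))
            (x + fun j => (2 * (n : ℤ) + 1) * (((v j : ℕ) : ℤ) - 1))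
            (y + fun j => (2 * (n : ℤ) + 1) * (((v j : ℕ) : ℤ) - 1) +
              if j = i then (2 * (n : ℤ) + 1) else 0)) :=
      Finset.sum_comm.trans
        (Finset.sum_congr rfl fun x _ => Finset.sum_congr rfl fun y _ => by rw [openConnIn_comm])
    rw [hsymm, two_mul]
    exact add_le_add h1 h1
  calc 36 * (∑ x ∈ (box 3 n).filter (fun x : Site 3 => x i ≤ -1),
          ∑ y ∈ (box 3 n).filter (fun y : Site 3 => 0 ≤ y i),
            (bondPercolation (zdGraph 3) p).real (openConnIn (↑(box 3 n) : Set (Site 3)) x y))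
      = ∑ _v ∈ Finset.univ.filter (fun v : Fin 3 → Fin 3 => (v i : ℕ) ≤ 1),
          2 * (∑ x ∈ (box 3 n).filter (fun x : Site 3 => x i ≤ -1),
            ∑ y ∈ (box 3 n).filter (fun y : Site 3 => 0 ≤ y i),
              (bondPercolation (zdGraph 3) p).real (openConnIn (↑(box 3 n) : Set (Site 3)) x y)) := by
        rw [Finset.sum_const, hcard, nsmul_eq_mul]
        push_cast
        ring
    _ ≤ _ := Finset.sum_le_sum hterm

end StraddlingGain

open StraddlingGain

/-- **stub_straddlingGain (STRADDLING GAIN; every `p`, `n`; line `Sketch-r2-ideator5` of crux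
`FreeBoxPowerSaving`).**  `27 S_p(n) + 36 Σ_{i<3} X_p^{(i)}(n) ≤ S_p(3n+1)`: `S_p(3n+1)` is a sum of
non-negative terms over ordered pairs of `B(3n+1)`; restrict it to the disjoint union of (a) the pairs
inside one of the 27 translates `c_v + B(n)`, `c_v = (2n+1)(v-1)`, `v ∈ {0,1,2}³` (each block
`≥ S_p(n)`: `diag_ge`, via `SubBoxesSuperadditive` and `stub_pairSumShift`) and (b) for each direction
`i`, each of the 18 adjacent block pairs `(v, v + e_i)` (`v_i ≤ 1`) and each orientation, the cross
pairs between the two blocks, each carrying at least `X^{(i)}(n)` (`stub_interfaceCrossMass`,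
`offdiag_ge`), `2 · 18 = 36` per direction; the bookkeeping is `sum_blockPairs_le` (injectivity of
`(v, x) ↦ x + c_v`, `add_offset_injOn`) and `blockPairs_le` (the three families of block pairs are
distinct). [folklore] -/
theorem stub_straddlingGain :
    ∀ (p : unitInterval) (n : ℕ),
      27 * (∑ x ∈ box 3 n, ∑ y ∈ box 3 n,
          (bondPercolation (zdGraph 3) p).real (openConnIn (↑(box 3 n) : Set (Site 3)) x y)) +
        36 * (∑ i : Fin 3, ∑ x ∈ (box 3 n).filter (fun x : Site 3 => x i ≤ -1),
          ∑ y ∈ (box 3 n).filter (fun y : Site 3 => 0 ≤ y i),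
            (bondPercolation (zdGraph 3) p).real (openConnIn (↑(box 3 n) : Set (Site 3)) x y)) ≤
      ∑ x ∈ box 3 (3 * n + 1), ∑ y ∈ box 3 (3 * n + 1),
        (bondPercolation (zdGraph 3) p).real (openConnIn (↑(box 3 (3 * n + 1)) : Set (Site 3)) x y) := by
  intro p n
  have hA := diag_ge p n
  have hB := offdiag_ge p n
  have hC := blockPairs_le
    (fun v w : Fin 3 → Fin 3 => ∑ x ∈ box 3 n, ∑ y ∈ box 3 n,
      (bondPercolation (zdGraph 3) p).real (openConnIn (↑(box 3 (3 * n + 1)) : Set (Site 3))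
        (x + fun j => (2 * (n : ℤ) + 1) * (((v j : ℕ) : ℤ) - 1))
        (y + fun j => (2 * (n : ℤ) + 1) * (((w j : ℕ) : ℤ) - 1))))
    (fun _ _ => Finset.sum_nonneg fun _ _ => Finset.sum_nonneg fun _ _ => measureReal_nonneg)
    (fun i => Finset.univ.filter (fun v : Fin 3 → Fin 3 => (v i : ℕ) ≤ 1))
  have hD := sum_blockPairs_le (bondPercolation (zdGraph 3) p)
    (fun (v : Fin 3 → Fin 3) (j : Fin 3) => (2 * (n : ℤ) + 1) * (((v j : ℕ) : ℤ) - 1))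
    (add_offset_mem_box n) (add_offset_injOn n)
  linarith

end Summit.CriticalPhenomena.PercolationContinuityZ3.FreeBoxPowerSavingLine

end
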